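import Mathlib.Data.ZMod.Basic
import Mathlib.SetTheory.Cardinal.Finite
import Mathlib.Algebra.Group.Subgroup.Basic
import HarnessLib

/-!
# Route `GenusKolyvaginAtTwo`, crux #2 `GenusPrimitiveSupplyAtTwo` (stmt-BirchSwinnertonDyer-22136):
# `𝔽₂`-ALGEBRA OF A HYPERBOLIC PLANE WITH TWO TRANSVERSAL ISOTROPIC LINES — the local linear algebra of the quadratic `iff` of the
# cell's T-2q `F1Sign2.TwoDoor.TwoTranspositionTwistLawAtTwo` (Poonen–Rains refinement at the three `T`-places `∞, q₀, q₁`)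

Width seat `bsd-line-gk2-p4` g14 (cell `bsd-f1-sign2`); lane: the two-transposition door. THEOREMS ONLY (no definition, no named fact, no
`sorry`); helper `--supports stmt-BirchSwinnertonDyer-22136`; no item is closed; BSD is not proved by any of this.

WHAT. At each `T`-place `v` of T-2q the local picture is: an `𝔽₂`-space `V = H¹(ℚ_v, E[2])` killed by `2`, a bi-additive pairing
`b = inv_v(· ∪ₑ ·)` with values in `ℤ/2`, a function `q` (the Poonen–Rains / Tate quadratic form) with polarisation `b`
(`q(x + y) = q x + q y + b x y`), and two ORDER-`2` subgroups `K = 𝓚_v` (Kummer condition of `W`) and `A = 𝓐_v` (transported Kummer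
condition of the twist) with `q|_K = q|_A = 0`, `A ⊓ K = ⊥`, and `K` containing its own right annihilator. This file proves the two
consequences the global argument consumes, as abstract group-theory lemmas:
* `pairing_ne_zero_of_transversal` — `b k a ≠ 0` for the non-zero `k ∈ K`, `a ∈ A` (non-degeneracy across the two lines);
* `mem_or_mem_of_isotropic` — THE QUADRATIC TRICHOTOMY: every `c` with `q c = 0` lies in `K` or in `A` (the fourth vector `k + a` of the
  plane `K ⊕ A` is ANISOTROPIC: `q(k + a) = b k a ≠ 0` — this is exactly where the quadratic refinement is load-bearing; with the bilinear
  form alone `k + a` would be admissible);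
plus `exists_ne_zero_of_natCard_eq_two` (structure of an order-`2` subgroup) and `polar_symm` (`b` is symmetric).

References: [PoonenRains2012] Cor. 4.6, Prop. 4.10/4.11, Thm. 4.14; [KlagsbrunMazurRubin2013] Def. 3.2, Lemma 5.2; [MazurRubin2010] Lemma 3.2.
-/

set_option linter.dupNamespace false -- tree convention: `Summit.BirchSwinnertonDyer.BirchSwinnertonDyer.Theorems` (summit = sub-problem)
set_option autoImplicit false

namespace Summit.BirchSwinnertonDyer.BirchSwinnertonDyer.Theorems.GenusKolyTransp

variable {V : Type*} [AddCommGroup V]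

/-! ## §23 Order-two subgroups and `ℤ/2`-valued pairings -/

/-- An order-`2` subgroup is `{0, g}` for a unique non-zero `g`. [folklore] -/
theorem exists_ne_zero_of_natCard_eq_two (H : AddSubgroup V) (h : Nat.card H = 2) :
    ∃ g ∈ H, g ≠ 0 ∧ ∀ x ∈ H, x = 0 ∨ x = g := by
  obtain ⟨y, hy, huniq⟩ := (Nat.card_eq_two_iff' (0 : H)).mp h
  refine ⟨y, y.2, fun h0 ↦ hy (Subtype.ext h0), fun x hx ↦ ?_⟩
  by_cases hx0 : x = 0
  · exact Or.inl hx0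
  · right
    have hx' : (⟨x, hx⟩ : H) ≠ 0 := fun h' ↦ hx0 (congrArg Subtype.val h')
    exact congrArg Subtype.val (huniq ⟨x, hx⟩ hx')

/-- The polarisation of a function is symmetric: `b x y = b y x` whenever `q(x + y) = q x + q y + b x y`. [folklore] -/
theorem polar_symm (b : V →+ V →+ ZMod 2) (q : V → ZMod 2) (hQ1 : ∀ x y, q (x + y) = q x + q y + b x y) (x y : V) :
    b x y = b y x := by
  have h1 := hQ1 x y
  have h2 := hQ1 y x
  rw [add_comm y x, h1, add_comm (q y) (q x)] at h2
  exact add_left_cancel h2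

/-! ## §24 Two transversal isotropic lines in a plane -/

/-- **Non-degeneracy across two transversal lines**: if `K` contains its right annihilator (`∀ y, (∀ x ∈ K, b x y = 0) → y ∈ K`),
`A ⊓ K = ⊥` and `#K = 2`, then `b k a ≠ 0` for every non-zero `k ∈ K` and non-zero `a ∈ A`. (At a `T`-place of T-2q: the Kummer
line of `W` pairs non-trivially with the twisted Kummer line — local Tate duality + transversality.)
[cite: MilneADT2006, Ch. I, Cor. 3.4 and Rem. 3.7] [cite: MazurRubin2010, Lemma 2.11] -/
theorem pairing_ne_zero_of_transversal (b : V →+ V →+ ZMod 2) (K A : AddSubgroup V)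
    (hann : ∀ y, (∀ x ∈ K, b x y = 0) → y ∈ K) (hKA : A ⊓ K = ⊥) (hK : Nat.card K = 2)
    {k : V} (hk : k ∈ K) (hk0 : k ≠ 0) {a : V} (ha : a ∈ A) (ha0 : a ≠ 0) : b k a ≠ 0 := by
  -- `a ∉ K`, so some `k' ∈ K` pairs non-trivially with `a`; `K = {0, g}` forces `k' = g = k`
  have haK : a ∉ K := fun haK ↦ ha0 (by
    have : a ∈ A ⊓ K := ⟨ha, haK⟩
    rw [hKA] at this
    exact (AddSubgroup.mem_bot).mp this)
  have hex : ∃ k' ∈ K, b k' a ≠ 0 := by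
    by_contra hno
    push Not at hno
    exact haK (hann a hno)
  obtain ⟨k', hk', hk'a⟩ := hex
  obtain ⟨g, -, -, hg⟩ := exists_ne_zero_of_natCard_eq_two K hK
  have hk'0 : k' ≠ 0 := by
    rintro rfl
    exact hk'a (by rw [map_zero, AddMonoidHom.zero_apply])
  have hk'g : k' = g := (hg k' hk').resolve_left hk'0
  have hkg : k = g := (hg k hk).resolve_left hk0
  rw [hkg, ← hk'g]
  exact hk'a

/-- **THE QUADRATIC TRICHOTOMY** (the local heart of T-2q's `iff`): with `q(x + y) = q x + q y + b x y`, two order-`2` subgroups `K, A` on which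
`q` vanishes, `A ⊓ K = ⊥`, `K` containing its right annihilator, and `2V = 0`: every `c` with `q c = 0` lies in `K` or in `A`. Indeed if
`c ∉ K` then `b g c ≠ 0` for the generator `g` of `K`, and `b g a ≠ 0` for the generator `a` of `A`, so `b g (c + a) = 0`, `c + a ∈ K`,
`c ∈ {a, g + a}`; but `q(g + a) = b g a ≠ 0`. [cite: PoonenRains2012, Prop. 4.10 and Prop. 4.11] [cite: KlagsbrunMazurRubin2013, Def. 3.2 and Lemma 5.2] -/
theorem mem_or_mem_of_isotropic (b : V →+ V →+ ZMod 2) (q : V → ZMod 2) (hQ1 : ∀ x y, q (x + y) = q x + q y + b x y)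
    (K A : AddSubgroup V) (hqK : ∀ x ∈ K, q x = 0) (hqA : ∀ x ∈ A, q x = 0)
    (hann : ∀ y, (∀ x ∈ K, b x y = 0) → y ∈ K) (hKA : A ⊓ K = ⊥) (hK : Nat.card K = 2) (hA : Nat.card A = 2)
    (h2 : ∀ x : V, x + x = 0) {c : V} (hc : q c = 0) : c ∈ K ∨ c ∈ A := by
  by_cases hcK : ∀ x ∈ K, b x c = 0
  · exact Or.inl (hann c hcK)
  right
  push Not at hcK
  obtain ⟨k, hk, hkc⟩ := hcK
  obtain ⟨g, hgK, hg0, hg⟩ := exists_ne_zero_of_natCard_eq_two K hK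
  obtain ⟨a, haA, ha0, ha⟩ := exists_ne_zero_of_natCard_eq_two A hA
  have hk0 : k ≠ 0 := by
    rintro rfl
    exact hkc (by rw [map_zero, AddMonoidHom.zero_apply])
  have hkg : k = g := (hg k hk).resolve_left hk0
  rw [hkg] at hkc
  have hga : b g a ≠ 0 := pairing_ne_zero_of_transversal b K A hann hKA hK hgK hg0 haA ha0
  have h01 : ∀ u : ZMod 2, u ≠ 0 → u = 1 := by decide
  have hgc1 : b g c = 1 := h01 _ hkc
  have hga1 : b g a = 1 := h01 _ hga
  -- `c + a ∈ K`
  have hca : c + a ∈ K := by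
    refine hann (c + a) fun x hx ↦ ?_
    rcases hg x hx with rfl | rfl
    · rw [map_zero, AddMonoidHom.zero_apply]
    · rw [map_add, hgc1, hga1]; decide
  have hcdecomp : c = (c + a) + a := by rw [add_assoc, h2 a, add_zero]
  rcases hg (c + a) hca with h0 | h1
  · -- `c + a = 0`: `c = a ∈ A`
    rw [hcdecomp, h0, zero_add]
    exact haA
  · -- `c + a = g`: `c = g + a` is anisotropic
    exfalso
    have hq : q c = b g a := by
      rw [hcdecomp, h1, hQ1, hqK g hgK, hqA a haA, zero_add, zero_add]
    rw [hq, hga1] at hc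
    exact one_ne_zero hc

end Summit.BirchSwinnertonDyer.BirchSwinnertonDyer.Theorems.GenusKolyTransp
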